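import Summits.BirchSwinnertonDyer.BirchSwinnertonDyer.Theorems.ManinLocalTwoThreeShimuraIndexOfIrreducible
import Literature.NumberTheory.EllipticCurves.EisensteinCongruenceRationalTorsionProofs
import Literature.NumberTheory.EllipticCurves.ModularityVersionApProofs
import Literature.NumberTheory.EllipticCurves.CuspFormLFunctionLevelConductorProofs
import HarnessLib

/-!
# Cusp lifting UP TO ISOGENY: `p ∣ [Λ₀(f) : Λ₁(f)]` forces a rational point of order `p` on a curve `p`-isogenous to `W`
# (Katz); E-an-129 (`ℓ ≥ 11 ⟹ ℓ ∤ [Λ₀ : Λ₁]`) holds modulo Mazur's torsion theorem ALONE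

Summit `BirchSwinnertonDyer`, route `ManinLocalTwoThree` (cell bsd-f2-manin), crux C2 `ManinOddAtFour`
(stmt-BirchSwinnertonDyer-22967; bears equally on C3 stmt-BirchSwinnertonDyer-22968).  Prover seat bsd-line-manin23-p1
(C2/C3 LEAD), gen 9; sequel to `ManinLocalTwoThreeShimuraIndexOfIrreducible.lean`.

For the newform `f` of a globally minimal elliptic `W/ℚ` (any level `N`, no optimality) and a prime `p`:

* `dvd_frobeniusTrace_sub_of_not_shimuraIndexPrimeTo` — if `Λ₀(f)/Λ₁(f)` has an element of order `p` then
  `a_ℓ(W) ≡ ℓ + 1 (mod p)` at EVERY good prime `ℓ` (Ribet's Eisenstein property of `Σ(N)` in the tree's lattice form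
  `sub_sub_mul_mem_periodLatticeGamma1_of_isNewform0` + Bézout; `ℓ ∤ N` from `IsNewformOf.dvd_level_iff_dvd_conductorNorm`).
* **`exists_isogeny_addOrderOf_eq_of_not_shimuraIndexPrimeTo`** — hence, by KATZ'S THEOREM in the tree
  (`exists_isogeny_addOrderOf_eq_of_frobeniusTrace_congr`, Katz 1981 Thm. 2 at `m = p`): there is a `ℚ`-isogeny
  `g : W → W'` of degree dividing `p` onto an elliptic curve with a RATIONAL POINT OF ORDER `p`.  This is the honest,
  unconditional shape of an's cusp-lifting laws E-an-128 / 128ℓ (`ShimuraCuspLifting.lean`), which assert the point on the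
  lattice-optimal `W` itself (that needs «`Σ(N)` is of μ-type», not in the tree).
* `shimuraIndexPrimeTo_of_forall_isogeny_addOrderOf_ne` — contrapositive: no rational `p`-torsion on `W` and on its
  `p`-isogenous curves ⟹ `ShimuraIndexPrimeTo p f`.
* **`shimuraIndexPrimeTo_of_eleven_le_of_mazur_torsion`** — for every prime `p ≥ 11`: `ShimuraIndexPrimeTo p f`, modulo the
  named Literature fact `mazur_torsion` ONLY (Mazur 1977 Thm. 8) — an's **E-an-129** (`ShimuraCuspLifting.lean` §3, there
  PROVED from E-an-128ℓ + `mazur_torsion`) with its E-an-128ℓ hypothesis DISCHARGED: `shimuraIndexPrimeTo_of_eleven_le'`,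
  `plusIndexPrimeTo_of_eleven_le'`; also from the printed leaves of Mazur's theorem
  (`shimuraIndexPrimeTo_of_eleven_le_of_mazur_leaves`).  So the Shimura-cover kernel `Λ₀(f)/Λ₁(f)` of an elliptic newform
  has order supported on `{2, 3, 5, 7}` (granted Mazur).
* `p = 3` (C3): `plusIndexPrimeTo_three_of_forall_isogeny_addOrderOf_ne` — no rational `3`-torsion on `W` nor on its
  `3`-isogenous curves ⟹ `PlusIndexPrimeTo 3 f` (es's E-es-67 on the class-`3`-torsion-free locus, every level), and the
  `3`-adic polar witness from E-es-66 alone there.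

HONEST FRAMING: unconditional tree theorems (standard axioms) except where `mazur_torsion` / Mazur's printed leaves are
taken as hypotheses (CONDITIONAL on those named Literature facts).  The crux stubs of C2 v13 / C3 v17 are NOT narrowed;
E-an-128/128ℓ themselves (the point on the OPTIMAL curve) are NOT proved.  C2, C3, Manin's conjecture and BSD are NOT
proved by this file.  No definitions, no named facts introduced, no sorry.

References: N. M. Katz, *Galois properties of torsion points on abelian varieties*, Invent. Math. 62 (1981), Thm. 2
[Katz1980]; K. Ribet, Sém. Th. Nombres Bordeaux 1987–88, exp. 6 [Ribet1988Shimura]; B. Mazur, Publ. Math. IHÉS 47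
(1977), Thm. 8 [Mazur1977]; V. Vatsal, J. Inst. Math. Jussieu 4 (2005), Rem. 1.8 [Vatsal2005].
-/

set_option autoImplicit false
set_option linter.dupNamespace false

noncomputable section

open scoped Classical MatrixGroups ModularForm

open CongruenceSubgroup Complex WeierstrassCurve Literature.NumberTheory.EllipticCurves
  Literature.NumberTheory.EllipticCurves.ModularForms
open Summit.BirchSwinnertonDyer.Rank1Residual.ManinAdditive.KatoCurve
  Summit.BirchSwinnertonDyer.Rank1Residual.ManinAdditive.CuspidalKummer

namespace Summit.BirchSwinnertonDyer.BirchSwinnertonDyer.Theorems.ManinLocalTwoThree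

variable (W : WeierstrassCurve ℚ) [W.IsElliptic] [W.IsGloballyMinimal] {N : ℕ} [NeZero N]

/-! ### §1. `p ∣ [Λ₀ : Λ₁]` ⟹ the Eisenstein congruence `a_ℓ ≡ ℓ + 1 (mod p)` at EVERY good prime -/

/-- **`p ∣ [Λ₀(f) : Λ₁(f)]` forces `a_ℓ(W) ≡ ℓ + 1 (mod p)` at every prime `ℓ` of good reduction.**  A class
`x ∈ Λ₀(f) ∖ Λ₁(f)` with `p x ∈ Λ₁(f)` is killed by every Eisenstein number `a_ℓ(f) − ℓ − 1`, `ℓ ∤ N` (tree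
`sub_sub_mul_mem_periodLatticeGamma1_of_isNewform0`); were one of them prime to `p`, Bézout would put `x` in `Λ₁(f)`.
Good reduction at `ℓ` gives `ℓ ∤ N_W` (`dvd_conductorNorm_iff_not_hasGoodReductionAtPrime`), hence `ℓ ∤ N`
(`IsNewformOf.dvd_level_iff_dvd_conductorNorm`), and `a_ℓ(f) = a_ℓ(W)` (`LFunction_apply_prime_eq_frobeniusTrace`).
[cite: Ribet1988Shimura, Thm. 1 and §3] [cite: DiamondShurman2005, Prop. 5.8.5 and (8.44)] -/
theorem dvd_frobeniusTrace_sub_of_not_shimuraIndexPrimeTo {f : CuspForm (Gamma0 N) 2} (hf : IsNewformOf W f)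
    {p : ℕ} (hp : p.Prime) (hS : ¬ ShimuraIndexPrimeTo p f) {ℓ : ℕ} [hℓ : Fact ℓ.Prime]
    (hgood : W.HasGoodReductionAtPrime ℓ) : (p : ℤ) ∣ W.frobeniusTrace ℓ - (ℓ + 1) := by
  by_contra hnot
  apply hS
  intro x hx hpx
  have hℓNW : ¬ ℓ ∣ W.conductorNorm ℤ := fun h ↦
    ((W.dvd_conductorNorm_iff_not_hasGoodReductionAtPrime ℓ).mp h) hgood
  have hℓN : ¬ ℓ ∣ N := fun h ↦ hℓNW ((hf.dvd_level_iff_dvd_conductorNorm hℓ.out).mp h)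
  haveI : NeZero ℓ := ⟨hℓ.out.ne_zero⟩
  have hE := sub_sub_mul_mem_periodLatticeGamma1_of_isNewform0 f hf.1 hℓ.out hℓN hx
  rw [hf.2 ℓ, LFunction_apply_prime_eq_frobeniusTrace W ℓ hgood] at hE
  have hE' : ((W.frobeniusTrace ℓ - (ℓ + 1) : ℤ) : ℂ) * x ∈ periodLatticeGamma1 f := by
    convert hE using 2
    push_cast
    ring
  exact mem_of_intCast_mul_mem_of_prime_mul_mem hp hnot hE' hpx

/-! ### §2. Katz: a rational `p`-torsion point on a `p`-isogenous curve -/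

/-- **Cusp lifting up to isogeny (PROVED).**  If `Λ₀(f)/Λ₁(f)` has an element of order `p` (`¬ ShimuraIndexPrimeTo p f`)
for the newform `f` of a globally minimal elliptic `W/ℚ`, then there are an elliptic curve `W'/ℚ`, a `ℚ`-isogeny
`g : W → W'` of degree dividing `p`, and a rational point of order `p` on `W'`.  (§1 + Katz's theorem in the tree,
`exists_isogeny_addOrderOf_eq_of_frobeniusTrace_congr`.)  For odd `p` this is the unconditional part of an's E-an-128ℓ;
the passage from `W'` to the optimal `W` itself is NOT proved.
[cite: Katz1980, Thm. 2 (m = ℓ)] [cite: Ribet1988Shimura, Thm. 1 and §3] -/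
theorem exists_isogeny_addOrderOf_eq_of_not_shimuraIndexPrimeTo {f : CuspForm (Gamma0 N) 2} (hf : IsNewformOf W f)
    {p : ℕ} (hp : p.Prime) (hS : ¬ ShimuraIndexPrimeTo p f) :
    ∃ (W' : WeierstrassCurve ℚ) (_ : W'.IsElliptic) (g : Isogeny W W'),
      g.degree ∣ p ∧ ∃ Q : W'.toAffine.Point, addOrderOf Q = p := by
  haveI : Fact p.Prime := ⟨hp⟩
  exact exists_isogeny_addOrderOf_eq_of_frobeniusTrace_congr W p
    fun ℓ _ _ hgood ↦ dvd_frobeniusTrace_sub_of_not_shimuraIndexPrimeTo W hf hp hS hgood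

/-- Contrapositive: **if neither `W` nor any curve reached from `W` by a `ℚ`-isogeny of degree dividing `p` has a
rational point of order `p`, then `p ∤ [Λ₀(f) : Λ₁(f)]`** (`ShimuraIndexPrimeTo p f`).
[cite: Katz1980, Thm. 2 (m = ℓ)] [cite: Ribet1988Shimura, Thm. 1 and §3] -/
theorem shimuraIndexPrimeTo_of_forall_isogeny_addOrderOf_ne {f : CuspForm (Gamma0 N) 2} (hf : IsNewformOf W f)
    {p : ℕ} (hp : p.Prime)
    (h : ∀ (W' : WeierstrassCurve ℚ) [W'.IsElliptic] (g : Isogeny W W'), g.degree ∣ p →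
      ∀ Q : W'.toAffine.Point, addOrderOf Q ≠ p) :
    ShimuraIndexPrimeTo p f := by
  by_contra hS
  obtain ⟨W', hW', g, hg, Q, hQ⟩ := exists_isogeny_addOrderOf_eq_of_not_shimuraIndexPrimeTo W hf hp hS
  exact h W' g hg Q hQ

/-- The plus-index form: no rational `p`-torsion on `W` and its `p`-isogenous curves ⟹ `PlusIndexPrimeTo p f`.
[cite: Katz1980, Thm. 2 (m = ℓ)] [cite: LingOesterle1991, §1] -/
theorem plusIndexPrimeTo_of_forall_isogeny_addOrderOf_ne {f : CuspForm (Gamma0 N) 2} (hf : IsNewformOf W f)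
    {p : ℕ} (hp : p.Prime)
    (h : ∀ (W' : WeierstrassCurve ℚ) [W'.IsElliptic] (g : Isogeny W W'), g.degree ∣ p →
      ∀ Q : W'.toAffine.Point, addOrderOf Q ≠ p) :
    PlusIndexPrimeTo p f :=
  plusIndexPrimeTo_of_shimuraIndexPrimeTo hp f (shimuraIndexPrimeTo_of_forall_isogeny_addOrderOf_ne W hf hp h)

/-! ### §3. `p ≥ 11`: E-an-129 modulo Mazur's torsion theorem alone -/

/-- **For every prime `p ≥ 11`, `p ∤ [Λ₀(f) : Λ₁(f)]`** — granted Mazur's torsion theorem (named Literature fact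
`mazur_torsion`, Mazur 1977 Thm. 8) for all elliptic curves over `ℚ`: a rational point of order `p ≥ 11` on the
`p`-isogenous curve of §2 is impossible (`not_exists_addOrderOf_eq_of_mazur_torsion`).  CONDITIONAL on `mazur_torsion`.
[cite: Mazur1977, Thm. (8)] [cite: Katz1980, Thm. 2 (m = ℓ)] -/
theorem shimuraIndexPrimeTo_of_eleven_le_of_mazur_torsion (hMT : ∀ V : WeierstrassCurve ℚ, mazur_torsion V)
    {f : CuspForm (Gamma0 N) 2} (hf : IsNewformOf W f) {p : ℕ} (hp : p.Prime) (h11 : 11 ≤ p) :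
    ShimuraIndexPrimeTo p f :=
  shimuraIndexPrimeTo_of_forall_isogeny_addOrderOf_ne W hf hp fun W' _ _g _hg Q hQ ↦
    not_exists_addOrderOf_eq_of_mazur_torsion W' (hMT W') hp h11 ⟨Q, hQ⟩

/-- The same from the printed leaves of Mazur's theorem (`Mazur1977_no_prime_torsion`: no rational point of prime
order outside `{2, 3, 5, 7, 13}`; `MazurTate1973_no_torsion_thirteen`).  CONDITIONAL on those two named facts.
[cite: Mazur1977, Ch. III §5] [cite: Katz1980, Thm. 2 (m = ℓ)] -/
theorem shimuraIndexPrimeTo_of_eleven_le_of_mazur_leaves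
    (h5 : ∀ V : WeierstrassCurve ℚ, Mazur1977_no_prime_torsion V)
    (h13 : ∀ V : WeierstrassCurve ℚ, MazurTate1973_no_torsion_thirteen V)
    {f : CuspForm (Gamma0 N) 2} (hf : IsNewformOf W f) {p : ℕ} (hp : p.Prime) (h11 : 11 ≤ p) :
    ShimuraIndexPrimeTo p f := by
  refine shimuraIndexPrimeTo_of_forall_isogeny_addOrderOf_ne W hf hp fun W' _ _g _hg Q hQ ↦ ?_
  by_cases hp13 : p = 13
  · subst hp13
    exact h13 W' ⟨Q, hQ⟩
  · refine h5 W' p hp ?_ ⟨Q, hQ⟩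
    simp only [Finset.mem_insert, Finset.mem_singleton, not_or]
    omega

/-- **E-an-129 with E-an-128ℓ DISCHARGED** (the leaf's `shimuraIndexPrimeTo_of_eleven_le` took
`h : ShimuraOddPrimeForcesRationalTorsion`; here only `mazur_torsion`): for every `X₀(N)`-datum `D` of a globally
minimal elliptic `W` (the lattice-optimality binder of the leaf is not needed) and every prime `ℓ ≥ 11`,
`ShimuraIndexPrimeTo ℓ D.f`.  CONDITIONAL on `mazur_torsion`. [cite: Mazur1977, Thm. (8)] [cite: Katz1980, Thm. 2 (m = ℓ)] -/
theorem shimuraIndexPrimeTo_of_eleven_le' (hMT : ∀ V : WeierstrassCurve ℚ, mazur_torsion V)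
    (D : ModularParametrizationData W N) {ℓ : ℕ} (hℓ : ℓ.Prime) (h11 : 11 ≤ ℓ) :
    ShimuraIndexPrimeTo ℓ D.f :=
  shimuraIndexPrimeTo_of_eleven_le_of_mazur_torsion W hMT D.isNewformOf hℓ h11

/-- Hence the plus index is prime to every `ℓ ≥ 11` (the leaf's `plusIndexPrimeTo_of_eleven_le` with E-an-128ℓ
discharged).  CONDITIONAL on `mazur_torsion`. [cite: Mazur1977, Thm. (8)] [cite: LingOesterle1991, §1] -/
theorem plusIndexPrimeTo_of_eleven_le' (hMT : ∀ V : WeierstrassCurve ℚ, mazur_torsion V)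
    (D : ModularParametrizationData W N) {ℓ : ℕ} (hℓ : ℓ.Prime) (h11 : 11 ≤ ℓ) :
    PlusIndexPrimeTo ℓ D.f :=
  plusIndexPrimeTo_of_shimuraIndexPrimeTo hℓ D.f (shimuraIndexPrimeTo_of_eleven_le' W hMT D hℓ h11)

/-- **The Shimura-cover kernel is supported on `{2, 3, 5, 7}`** (granted `mazur_torsion`): for every prime
`p ∉ {2, 3, 5, 7}`, `ShimuraIndexPrimeTo p f`.  CONDITIONAL on `mazur_torsion`. [cite: Mazur1977, Thm. (8)] [cite: Katz1980, Thm. 2 (m = ℓ)] -/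
theorem shimuraIndexPrimeTo_of_prime_of_not_mem (hMT : ∀ V : WeierstrassCurve ℚ, mazur_torsion V)
    {f : CuspForm (Gamma0 N) 2} (hf : IsNewformOf W f) {p : ℕ} (hp : p.Prime)
    (hmem : p ∉ ({2, 3, 5, 7} : Finset ℕ)) : ShimuraIndexPrimeTo p f := by
  refine shimuraIndexPrimeTo_of_eleven_le_of_mazur_torsion W hMT hf hp ?_
  simp only [Finset.mem_insert, Finset.mem_singleton, not_or] at hmem
  obtain ⟨h2, h3, h5, h7⟩ := hmem
  by_contra hlt
  push Not at hlt
  interval_cases p <;> first | exact absurd hp (by decide) | omega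

/-! ### §4. `p = 3` (C3): plus index prime to `3` on the class-`3`-torsion-free locus -/

/-- **E-es-67 on the class-`3`-torsion-free locus, every level (PROVED):** if neither `W` nor any curve reached from
`W` by a `ℚ`-isogeny of degree `1` or `3` has a rational point of order `3`, then `PlusIndexPrimeTo 3 f`.
(Compare the leaf's E-es-67 `PlusIndexPrimeToThreeOfNoRationalThreeTorsion`, which asks no rational `3`-torsion on the
lattice-optimal `W` only, at `9 ∣ N`; the gap is exactly the μ₃-case E-es-67♯.) [cite: Katz1980, Thm. 2 (m = ℓ)] [cite: LingOesterle1991, §1] -/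
theorem plusIndexPrimeTo_three_of_forall_isogeny_addOrderOf_ne {f : CuspForm (Gamma0 N) 2} (hf : IsNewformOf W f)
    (h : ∀ (W' : WeierstrassCurve ℚ) [W'.IsElliptic] (g : Isogeny W W'), g.degree ∣ 3 →
      ∀ Q : W'.toAffine.Point, addOrderOf Q ≠ 3) :
    PlusIndexPrimeTo 3 f :=
  plusIndexPrimeTo_of_forall_isogeny_addOrderOf_ne W hf Nat.prime_three h

/-- With es's E-es-66 `ThreeAdicWitnessOfPlusIndexPrimeToThree` ALONE: a lattice-optimal `W` with `9 ∣ N` whose class is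
`3`-torsion-free up to `3`-isogeny carries a `3`-adic polar witness. [cite: Katz1980, Thm. 2 (m = ℓ)] -/
theorem threeAdicPolarWitness_of_forall_isogeny_addOrderOf_ne (h66 : ThreeAdicWitnessOfPlusIndexPrimeToThree)
    (D : ModularParametrizationData W N) (hopt : ∀ z ∈ D.L.lattice, ∃ w ∈ periodLattice D.f, z = D.c * w)
    (h9 : 3 ^ 2 ∣ N)
    (h : ∀ (W' : WeierstrassCurve ℚ) [W'.IsElliptic] (g : Isogeny W W'), g.degree ∣ 3 →
      ∀ Q : W'.toAffine.Point, addOrderOf Q ≠ 3) :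
    ThreeAdicPolarWitness W W D.f :=
  h66 W D hopt h9 (plusIndexPrimeTo_three_of_forall_isogeny_addOrderOf_ne W D.isNewformOf h)

/-! ### §5. `p = 2`: the isogeny form collapses to E-an-128₂ (consistency) -/

/-- At `p = 2` the isogeny form says: `2 ∣ [Λ₀ : Λ₁]` ⟹ `W` or a `2`-isogenous curve has a rational `2`-torsion point —
consistent with (and weaker than) E-an-128₂ `shimuraTwoForcesRationalTwoTorsion_holds` of the sibling file, which puts the
point on `W` itself. Recorded for the ledger. [cite: Katz1980, Thm. 2 (m = ℓ)] -/
theorem exists_isogeny_addOrderOf_eq_two_of_not_shimuraIndexPrimeTo_two {f : CuspForm (Gamma0 N) 2}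
    (hf : IsNewformOf W f) (hS : ¬ ShimuraIndexPrimeTo 2 f) :
    ∃ (W' : WeierstrassCurve ℚ) (_ : W'.IsElliptic) (g : Isogeny W W'),
      g.degree ∣ 2 ∧ ∃ Q : W'.toAffine.Point, addOrderOf Q = 2 :=
  exists_isogeny_addOrderOf_eq_of_not_shimuraIndexPrimeTo W hf Nat.prime_two hS

end Summit.BirchSwinnertonDyer.BirchSwinnertonDyer.Theorems.ManinLocalTwoThree

end
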